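import Literature.Analysis.FluidPDE.TaoClassGlue
import Literature.Analysis.FluidPDE.LerayEnstrophyAPrioriHolds
import Literature.Analysis.FluidPDE.TaoH1APrioriProofs

/-! # One step of the local `H¹` theory for Tao-class solutions —
crux stmt-NavierStokesRegularity-0727 (`CertifiedBlowup.CertifiedBlowupAxisymBlowup`), line
`compact-amplification`, stub `stub_h1_step`

PROVED, exactly as registered: for every viscosity `ν > 0` and data bound `A ≥ 0` there is a
lifespan `σ > 0`, an enstrophy bound `S` and an `H²` bound `H` such that every Tao-class solution
`(w, q)` on a slab `[0, T]`, `0 < T ≤ σ`, from a datum `w₀` with `∫‖w₀‖² + ∫|∇w₀|² ≤ A` has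
enstrophy `∫|∇w(t)|² ≤ S` on `[0, T]`, and, at the end of a full step (`T = σ`),
`∫‖D²w(σ)‖² ≤ H`.

**Proof.** Bookkeeping around two facts proved in the tree. The enstrophy a priori bound with
lifespan (`Literature.Analysis.FluidPDE.leray_enstrophy_apriori_holds`, Robinson–Rodrigo–Sadowski
2016, (6.6)–(6.10), Cor. 6.9) supplies absolute `c, K > 0`; with `σ := c ν³ / (A² + 1)` the
smallness `A² T ≤ c ν³` holds for `T ≤ σ`, whence `∫|∇w(t)|² ≤ K A =: S` on `[0, T]` and
`ν ∫₀ᵀ∫‖D²w‖² ≤ K A`. The energy inequality of the class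
(`Literature.Analysis.FluidPDE.IsTaoSolutionOn.lintegral_enorm_sq_le`) gives `∫‖w(t)‖² ≤ ∫‖w₀‖² ≤ A`.
Quantitative regularity (`Literature.Analysis.FluidPDE.tao2011_quantitative_regularity_holds`,
Tao 2013, Lemma 5.5) at order `k = 2` on `[σ/2, σ]` with the bounds `E = A`, `S = K A`,
`I = K A / ν` then gives the constant `H`.
-/

set_option linter.dupNamespace false

noncomputable section

open MeasureTheory Set Function Filter Topology
open scoped ENNReal NNReal ContDiff

namespace Summit.NavierStokesRegularity.NavierStokesRegularity.Theorems.CertifiedBlowupAxisymBlowup.CompactAmplification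

open Literature.Analysis.FluidPDE

local notation "ℝ³" => EuclideanSpace ℝ (Fin 3)

/-- The lifespan `σ = c ν³ / (A² + 1)` obeys the smallness condition `A² σ ≤ c ν³` of the
enstrophy a priori bound, and so does every `T ≤ σ`. -/
theorem h1_step_smallness {c ν A T : ℝ} (hc : 0 < c) (hν : 0 < ν)
    (hT : T ≤ c * ν ^ 3 / (A ^ 2 + 1)) : A ^ 2 * T ≤ c * ν ^ 3 := by
  have hA1 : (0 : ℝ) < A ^ 2 + 1 := by positivity
  have hcν : 0 ≤ c * ν ^ 3 := mul_nonneg hc.le (pow_nonneg hν.le 3)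
  calc A ^ 2 * T ≤ A ^ 2 * (c * ν ^ 3 / (A ^ 2 + 1)) :=
        mul_le_mul_of_nonneg_left hT (sq_nonneg A)
    _ ≤ (A ^ 2 + 1) * (c * ν ^ 3 / (A ^ 2 + 1)) :=
        mul_le_mul_of_nonneg_right (le_add_of_nonneg_right zero_le_one)
          (div_nonneg hcν hA1.le)
    _ = c * ν ^ 3 := by
        field_simp

/-- Division of the dissipation bound `ν ∫₀ᵀ∫‖D²w‖² ≤ K A` by the viscosity, in `[0, ∞]` with
the quotient rendered as the coercion of `(K A / ν).toNNReal`. -/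
theorem h1_step_dissipation_div {ν B : ℝ} {D : ℝ≥0∞} (hν : 0 < ν)
    (h : ENNReal.ofReal ν * D ≤ ENNReal.ofReal B) : D ≤ ((B / ν).toNNReal : ℝ≥0∞) := by
  have hν' : ENNReal.ofReal ν ≠ 0 := (ENNReal.ofReal_pos.2 hν).ne'
  have h3 : D ≤ ENNReal.ofReal B / ENNReal.ofReal ν := by
    rw [ENNReal.le_div_iff_mul_le (Or.inl hν') (Or.inl ENNReal.ofReal_ne_top), mul_comm]
    exact h
  refine h3.trans (le_of_eq ?_)
  rw [← ENNReal.ofReal_div_of_pos hν]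
  rfl

/-- Energy bound of a Tao-class solution in terms of the data bound: if
`∫‖w₀‖² + ∫|∇w₀|² ≤ A` then `∫‖w(t)‖² ≤ A` on `[0, T]` (Leray–Hopf energy inequality of the
class). -/
theorem h1_step_energy {T ν A : ℝ} {w₀ : ℝ³ → ℝ³} {w : ℝ → ℝ³ → ℝ³} {q : ℝ → ℝ³ → ℝ}
    (hw : IsTaoSolutionOn T ν w₀ w q) (hT : 0 < T) (hν : 0 ≤ ν)
    (hA : (∫⁻ x, ‖w₀ x‖ₑ ^ 2) + (∫⁻ x, ENNReal.ofReal (frobeniusNormSq (fderiv ℝ w₀ x))) ≤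
      ENNReal.ofReal A) {t : ℝ} (ht : t ∈ Icc 0 T) :
    ∫⁻ x, ‖w t x‖ₑ ^ 2 ≤ ENNReal.ofReal A := by
  have hmem : MemLp w₀ 2 volume := by
    rw [← hw.initial]
    exact hw.continuousL2.1 0 ⟨le_rfl, hT.le⟩
  have hE : eEnergy w₀ ≤ ENNReal.ofReal A := le_self_add.trans hA
  calc ∫⁻ x, ‖w t x‖ₑ ^ 2 ≤ ENNReal.ofReal (2 * VectorCalculus.kineticEnergy w₀) :=
        hw.lintegral_enorm_sq_le hT hν ht
    _ = eEnergy w₀ := (eEnergy_eq_ofReal w₀ hmem).symm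
    _ ≤ ENNReal.ofReal A := hE

/-- **One step of the local `H¹` theory** (stub `stub_h1_step` of the line
`compact-amplification`): for `ν > 0` and `A ≥ 0` there are a lifespan `σ > 0`, an enstrophy bound
`S` and an `H²` bound `H` such that every Tao-class solution on a slab `[0, T]`, `0 < T ≤ σ`, from a
datum with `‖w₀‖²_{L²} + ∫|∇w₀|² ≤ A` has enstrophy `≤ S` on `[0, T]`, and, if `T = σ`, satisfies
`∫ ‖D²w(σ)‖² ≤ H` (enstrophy a priori bound with lifespan, `leray_enstrophy_apriori_holds`, plus
quantitative smoothing at positive time, `tao2011_quantitative_regularity_holds`, plus the energy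
inequality). -/
theorem stub_h1_step :
    ∀ ν : ℝ, 0 < ν → ∀ A : ℝ, 0 ≤ A → ∃ σ : ℝ, 0 < σ ∧ ∃ S H : ℝ,
      ∀ (T : ℝ) (w₀ : ℝ³ → ℝ³) (w : ℝ → ℝ³ → ℝ³) (q : ℝ → ℝ³ → ℝ), 0 < T → T ≤ σ →
        IsTaoSolutionOn T ν w₀ w q →
        (∫⁻ x, ‖w₀ x‖ₑ ^ 2) + (∫⁻ x, ENNReal.ofReal (frobeniusNormSq (fderiv ℝ w₀ x))) ≤
          ENNReal.ofReal A →
        (∀ t ∈ Set.Icc 0 T,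
            (∫⁻ x, ENNReal.ofReal (frobeniusNormSq (fderiv ℝ (w t) x))) ≤ ENNReal.ofReal S) ∧
          (T = σ → ∫⁻ x, ‖iteratedFDeriv ℝ 2 (w T) x‖ₑ ^ 2 ≤ ENNReal.ofReal H) := by
  intro ν hν A hA0
  obtain ⟨c, K, hc, _hK, hEA⟩ := leray_enstrophy_apriori_holds
  -- the lifespan, as a genuine variable
  obtain ⟨σ, hσ⟩ : ∃ σ : ℝ, σ = c * ν ^ 3 / (A ^ 2 + 1) := ⟨_, rfl⟩
  have hσpos : 0 < σ := by
    rw [hσ]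
    positivity
  -- the `H²` constant of quantitative regularity at order `2` on `[σ/2, σ]`
  obtain ⟨Cq, hCq⟩ := tao2011_quantitative_regularity_holds 2 hν (half_pos hσpos)
    (half_lt_self hσpos) A.toNNReal (K * A).toNNReal (K * A / ν).toNNReal
  refine ⟨σ, hσpos, K * A, (Cq : ℝ), fun T w₀ w q hT hTσ hw hA => ?_⟩
  -- the enstrophy a priori bound on `[0, T]`
  have h0 : (∫⁻ x, ENNReal.ofReal (frobeniusNormSq (fderiv ℝ (w 0) x))) ≤ ENNReal.ofReal A := by
    rw [hw.initial]
    exact le_add_self.trans hA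
  have hsmall : A ^ 2 * T ≤ c * ν ^ 3 := h1_step_smallness hc hν (hσ ▸ hTσ)
  obtain ⟨h1, h2⟩ := hEA hν hT hw.classical hw.sobolev hw.sobolev_dt hw.sobolev_p hA0 h0 hsmall
  refine ⟨h1, fun hTeq => ?_⟩
  -- a full step: `T = σ`
  subst hTeq
  have hI := h1_step_dissipation_div (B := K * A) hν h2
  have hE : ∀ t ∈ Icc 0 T, ∫⁻ x, ‖w t x‖ₑ ^ 2 ≤ ENNReal.ofReal A := fun t ht =>
    h1_step_energy hw hT hν.le hA ht
  rw [ENNReal.ofReal_coe_nnreal]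
  exact hCq hw.classical hw.sobolev hw.sobolev_dt hw.sobolev_p (fun t ht => hE t ht)
    (fun t ht => h1 t ht) hI T ⟨(half_lt_self hT).le, le_rfl⟩

end Summit.NavierStokesRegularity.NavierStokesRegularity.Theorems.CertifiedBlowupAxisymBlowup.CompactAmplification

end
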